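import Mathlib.Algebra.BigOperators.Group.Finset.Basic
import Mathlib.Algebra.Ring.Basic
import Literature.Computability.MetaComplexity.XorDerivation
import HarnessLib

/-!
# Pseudo-moments of an expanding XOR system with values in a commutative ring

Support file for item `stmt-PneNP-11444` (`LinearGeneratorModPFregeHard`, the `AC⁰[p]`-Frege
rung of route `ExpanderLinearGenerators`), first part of the POLYNOMIAL CALCULUS RUNG under it
(`…PolyCalcDegree.lean`: over every field of characteristic `≠ 2`, in particular `𝔽_p` for the
odd primes `p` of the item, PC refutations of the XOR-CNF of an `(r, c)`-boundary expander need
degree `> c r / 4` — Ben-Sasson–Impagliazzo / Buss–Grigoriev–Impagliazzo–Pitassi /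
Alekhnovich–Razborov).

`Literature/Computability/MetaComplexity/XorDerivation.lean` builds, for a family of scope
vectors `g : ι → ParityVec` with `±1` right-hand sides `b : ι → ℝ`, the Grigoriev–Schoenebeck
pseudo-moments `Ẽ[y_T] ∈ ℝ` (the sign of the unique small family of equations summing to `T`).
Its combinatorial half (`VecExpands`, `IsWitness`, `Derivable`, uniqueness of witnesses) is
value-free and is reused verbatim; this file re-does the SIGN half with values in an arbitrary
commutative ring `K` (we need `K = 𝔽_p`), following the real-valued proofs line by line:

* `famSignK b F = ∏_{i ∈ F} b i`, multiplicative along symmetric differences when `b i² = 1`;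
* `pseudoMomentK g b r d T ∈ K` and its calculus under expansion with `d ≤ c r / 2`:
  `pseudoMomentK_eq` (any witness computes it), `pseudoMomentK_zero` (`Ẽ[1] = 1`),
  `pseudoMomentK_add` (multiplicativity), `pseudoMomentK_index_add` (one more equation),
  `derivable_add_iff'`, `not_derivable_index_add'` (value-free transfer lemmas), and the PIVOT
  identity `pseudoMomentK_pivot` (`Ẽ[y_{T+U}] = Ẽ[y_{T+T₁}] Ẽ[y_{T₁+U}]` whenever `T₁ + U` is
  derivable) which drives the multiplication step of the PC lower bound.

Sources: D. Grigoriev, Theoret. Comput. Sci. 259 (2001) §2; E. Ben-Sasson, R. Impagliazzo,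
Comput. Complexity 19 (2010) §4; S. Buss, D. Grigoriev, R. Impagliazzo, T. Pitassi, JCSS 62
(2001) §4 (the sign bookkeeping for Tseitin/parity axioms in characteristic `≠ 2`).
Adapted from `Literature/Computability/MetaComplexity/XorDerivation.lean` (real-valued version).
-/

noncomputable section

set_option linter.dupNamespace false -- `Summit.PneNP.PneNP.…`: summit = sub-problem (D-0017)

namespace Summit.PneNP.PneNP.Theorems.PolyCalc

open Finset Literature.Computability.MetaComplexity
open scoped symmDiff

variable {ι : Type*} {K : Type*} [CommRing K]

/-! ### Ring-valued signs of families -/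

/-- The sign of a family of indices with values in `K`: `∏_{i ∈ F} b i` (the right-hand side of
the summed equation when `b i = ±1`). [Grigoriev 2001, §2; Buss–Grigoriev–Impagliazzo–Pitassi
2001, §4] [folklore] -/
def famSignK (b : ι → K) (F : Finset ι) : K :=
  ∏ i ∈ F, b i

/-- The empty family has sign `1`. [folklore] -/
@[simp] theorem famSignK_empty (b : ι → K) : famSignK b ∅ = 1 := by simp [famSignK]

/-- A single equation has its own sign. [folklore] -/
@[simp] theorem famSignK_singleton (b : ι → K) (i : ι) : famSignK b {i} = b i := by
  simp [famSignK]

/-- With `±1` right-hand sides the sign of `F ∆ G` is the product of the signs.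
[Grigoriev 2001, §2] [folklore] -/
theorem famSignK_symmDiff [DecidableEq ι] (b : ι → K) (hb : ∀ i, b i * b i = 1) (F G : Finset ι) :
    famSignK b (F ∆ G) = famSignK b F * famSignK b G := by
  unfold famSignK
  have hF : ∏ i ∈ F, b i = (∏ i ∈ F \ G, b i) * ∏ i ∈ F ∩ G, b i := by
    rw [← Finset.prod_union (Finset.disjoint_sdiff_inter F G), Finset.sdiff_union_inter]
  have hG : ∏ i ∈ G, b i = (∏ i ∈ G \ F, b i) * ∏ i ∈ F ∩ G, b i := by
    rw [Finset.inter_comm, ← Finset.prod_union (Finset.disjoint_sdiff_inter G F),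
      Finset.sdiff_union_inter]
  have hD : ∏ i ∈ F ∆ G, b i = (∏ i ∈ F \ G, b i) * ∏ i ∈ G \ F, b i := by
    rw [symmDiff_def, Finset.sup_eq_union, Finset.prod_union disjoint_sdiff_sdiff]
  have hC : (∏ i ∈ F ∩ G, b i) * ∏ i ∈ F ∩ G, b i = 1 := by
    rw [← Finset.prod_mul_distrib]
    exact Finset.prod_eq_one fun i _ => hb i
  rw [hF, hG, hD]
  linear_combination -((∏ i ∈ F \ G, b i) * (∏ i ∈ G \ F, b i)) * hC

/-! ### Ring-valued pseudo-moments -/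

open Classical in
/-- The `K`-valued PSEUDO-MOMENT `Ẽ[y_T]`: the sign `∏_{i ∈ F} b i` of a witnessing family if `T`
is derivable in degree `d`, and `0` otherwise (well defined under expansion, `pseudoMomentK_eq`).
[Grigoriev 2001, §2; Ben-Sasson–Impagliazzo 2010, §4] [folklore] -/
def pseudoMomentK (g : ι → ParityVec) (b : ι → K) (r : ℝ) (d : ℕ) (T : ParityVec) : K :=
  if h : Derivable g r d T then famSignK b (Classical.choose h.2) else 0

variable [DecidableEq ι] {g : ι → ParityVec} {b : ι → K} {r c : ℝ} {d : ℕ}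

/-- The pseudo-moment of a derivable vector is the sign of ANY of its witnesses.
[Grigoriev 2001, §2] [folklore] -/
theorem pseudoMomentK_eq (hexp : VecExpands g r c) (hc : 0 < c) (hd : (d : ℝ) ≤ c * r / 2)
    {T : ParityVec} {F : Finset ι} (h : IsWitness g r T F) (hT : T.support.card ≤ d) :
    pseudoMomentK g b r d T = famSignK b F := by
  have hD : Derivable g r d T := ⟨hT, F, h⟩
  rw [pseudoMomentK, dif_pos hD, isWitness_unique hexp hc hd (Classical.choose_spec hD.2) h hT]

omit [DecidableEq ι] in
/-- Non-derivable vectors have pseudo-moment `0`. [Grigoriev 2001, §2] [folklore] -/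
theorem pseudoMomentK_of_not {T : ParityVec} (h : ¬ Derivable g r d T) :
    pseudoMomentK g b r d T = 0 := by
  rw [pseudoMomentK, dif_neg h]

/-- Normalisation `Ẽ[1] = 1`. [Grigoriev 2001, §2] [folklore] -/
theorem pseudoMomentK_zero (hexp : VecExpands g r c) (hc : 0 < c) (hd : (d : ℝ) ≤ c * r / 2)
    (hr : 0 ≤ r) : pseudoMomentK g b r d 0 = 1 := by
  rw [pseudoMomentK_eq hexp hc hd (isWitness_zero_empty hr) (by simp), famSignK_empty]

/-- **Multiplicativity.** If `T₁`, `T₂` are derivable and `T₁ + T₂` has support `≤ d`, then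
`T₁ + T₂` is derivable and `Ẽ[y_{T₁+T₂}] = Ẽ[y_{T₁}] Ẽ[y_{T₂}]` (`b = ±1`).
[Grigoriev 2001, §2; Ben-Sasson–Impagliazzo 2010, §4] [folklore] -/
theorem pseudoMomentK_add (hexp : VecExpands g r c) (hc : 0 < c) (hd : (d : ℝ) ≤ c * r / 2)
    (hb : ∀ i, b i * b i = 1) {T₁ T₂ : ParityVec} (h₁ : Derivable g r d T₁)
    (h₂ : Derivable g r d T₂) (h12 : (T₁ + T₂).support.card ≤ d) :
    Derivable g r d (T₁ + T₂) ∧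
      pseudoMomentK g b r d (T₁ + T₂) = pseudoMomentK g b r d T₁ * pseudoMomentK g b r d T₂ := by
  obtain ⟨hT₁, F₁, hF₁⟩ := h₁
  obtain ⟨hT₂, F₂, hF₂⟩ := h₂
  have hc1 := hF₁.card_le_half hexp hc hd hT₁
  have hc2 := hF₂.card_le_half hexp hc hd hT₂
  have hw := hF₁.symmDiff hF₂ (by linarith)
  refine ⟨⟨h12, _, hw⟩, ?_⟩
  rw [pseudoMomentK_eq hexp hc hd hw h12, pseudoMomentK_eq hexp hc hd hF₁ hT₁,
    pseudoMomentK_eq hexp hc hd hF₂ hT₂, famSignK_symmDiff b hb]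

/-- Derivability transfers along a derivable summand: if `T₁` is derivable then `T₂` is iff
`T₁ + T₂` is (supports `≤ d`; no sign hypothesis). [Grigoriev 2001, §2] [folklore] -/
theorem derivable_add_iff' (hexp : VecExpands g r c) (hc : 0 < c) (hd : (d : ℝ) ≤ c * r / 2)
    {T₁ T₂ : ParityVec} (h₁ : Derivable g r d T₁) (hT₂ : T₂.support.card ≤ d)
    (h12 : (T₁ + T₂).support.card ≤ d) :
    Derivable g r d T₂ ↔ Derivable g r d (T₁ + T₂) := by
  refine ⟨fun h₂ => Derivable.add hexp hc hd h₁ h₂ h12, fun h => ?_⟩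
  have := Derivable.add hexp hc hd h₁ h (by simpa using hT₂)
  simpa using this

/-- **One more equation.** For an index `i` (`r ≥ 2`): if `T` is derivable and `g i + T` has
support `≤ d`, then `g i + T` is derivable with `Ẽ[y_{g i + T}] = b i · Ẽ[y_T]`.
[Grigoriev 2001, §2; Buss–Grigoriev–Impagliazzo–Pitassi 2001, §4] [folklore] -/
theorem pseudoMomentK_index_add (hexp : VecExpands g r c) (hc : 0 < c)
    (hd : (d : ℝ) ≤ c * r / 2) (hr : 2 ≤ r) (hb : ∀ i, b i * b i = 1) (i : ι) {T : ParityVec}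
    (h : Derivable g r d T) (hiT : (g i + T).support.card ≤ d) :
    Derivable g r d (g i + T) ∧
      pseudoMomentK g b r d (g i + T) = b i * pseudoMomentK g b r d T := by
  obtain ⟨hT, F, hF⟩ := h
  have hc1 := hF.card_le_half hexp hc hd hT
  have hi : IsWitness g r (g i) {i} := isWitness_singleton (by linarith) i
  have hw := hi.symmDiff hF (by simp; linarith)
  refine ⟨⟨hiT, _, hw⟩, ?_⟩
  rw [pseudoMomentK_eq hexp hc hd hw hiT, pseudoMomentK_eq hexp hc hd hF hT,
    famSignK_symmDiff b hb, famSignK_singleton]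

/-- Contrapositive form: if `T` is NOT derivable (support `≤ d`) then neither is `g i + T`
(`r ≥ 2`; no sign hypothesis). [Grigoriev 2001, §2] [folklore] -/
theorem not_derivable_index_add' (hexp : VecExpands g r c) (hc : 0 < c)
    (hd : (d : ℝ) ≤ c * r / 2) (hr : 2 ≤ r) (i : ι) {T : ParityVec} (h : ¬ Derivable g r d T)
    (hT : T.support.card ≤ d) : ¬ Derivable g r d (g i + T) := by
  rintro ⟨hiT, F, hF⟩
  have hc1 := hF.card_le_half hexp hc hd hiT
  have hi : IsWitness g r (g i) {i} := isWitness_singleton (by linarith) i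
  have hw := hi.symmDiff hF (by simp; linarith)
  rw [ParityVec.add_add_cancel_left] at hw
  exact h ⟨hT, _, hw⟩

/-- **The pivot identity.** If `T₁ + U` is derivable, and `T + T₁`, `T + U` have support `≤ d`,
then `Ẽ[y_{T+U}] = Ẽ[y_{T+T₁}] · Ẽ[y_{T₁+U}]` — whether or not `T + T₁` is derivable (if it is
not, neither is `T + U`, and both sides vanish). This is the form of the class structure of the
pseudo-moments used in the multiplication step of the PC lower bound.
[Buss–Grigoriev–Impagliazzo–Pitassi 2001, §4–5 (the operator `R`); Ben-Sasson–Impagliazzo 2010,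
§4] [folklore] -/
theorem pseudoMomentK_pivot (hexp : VecExpands g r c) (hc : 0 < c) (hd : (d : ℝ) ≤ c * r / 2)
    (hb : ∀ i, b i * b i = 1) {T T₁ U : ParityVec} (h₁ : Derivable g r d (T₁ + U))
    (hTT₁ : (T + T₁).support.card ≤ d) (hTU : (T + U).support.card ≤ d) :
    pseudoMomentK g b r d (T + U) =
      pseudoMomentK g b r d (T + T₁) * pseudoMomentK g b r d (T₁ + U) := by
  have hsum : T + T₁ + (T₁ + U) = T + U := ParityVec.add_add_add_cancel T T₁ U
  by_cases hD : Derivable g r d (T + T₁)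
  · have := (pseudoMomentK_add hexp hc hd hb hD h₁ (by rw [hsum]; exact hTU)).2
    rwa [hsum] at this
  · have hnot : ¬ Derivable g r d (T + U) := by
      intro hTUd
      refine hD ((derivable_add_iff' hexp hc hd h₁ hTT₁ ?_).2 ?_)
      · rw [add_comm, hsum]; exact hTU
      · rw [add_comm, hsum]; exact hTUd
    rw [pseudoMomentK_of_not hD, pseudoMomentK_of_not hnot, zero_mul]

end Summit.PneNP.PneNP.Theorems.PolyCalc
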